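import Summits.CriticalPhenomena.SAWScalingLimit.Theses.SAWBrickWallHomotopy
import Summits.CriticalPhenomena.SAWScalingLimit.Theorems.SAWBrickWallHomotopyModulusUniversalityAffineTransport
import Summits.CriticalPhenomena.SAWScalingLimit.Theorems.SAWMassiveIsingTiltHexEndpointApproxExists
import Literature.Probability.RandomPlanarGeometry.SAWBrickWallHex
import HarnessLib

/-!
# `ModulusUniversality`, line `birth`: stub L follows from the two-convention endpoint coupling

Helper file (`--supports stmt-CriticalPhenomena-5790`) of the line `birth` / `registered` for the
crux `SAWBrickWallHomotopy.ModulusUniversality` (skeleton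
`Summits/CriticalPhenomena/SAWScalingLimit/Cruxes/ModulusUniversality/Lines/birth.lean`): the
registered helper sub-goal `stub_jitteredLipMerging_of_endpointCoupling` of the open stub L
(`stub_jitteredLipMerging`), proved — the SOFT REDUCTION of L to one residual lattice estimate.

Stub L asks, for the affinity `B(x + iy) = 2x + i(2/√3)y`, every Dobrushin domain `E` and every
`ℤ²` endpoint approximation `(a, b)` along which the straight brick-wall law
`SAW.brickWallLaw E δ 0 (a δ) (b δ)` (`ℤ²` conventions, `t = 0`) is eventually a probability
measure, for SOME jittered endpoint approximation `(a', b')` (graph `hexGraph` embedded by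
`B ∘ hexCenter`) such that the straight and the jittered (`SAW.embLaw … x_c (a' δ) (b' δ)`) laws
merge on every bounded Lipschitz test function of the curve.  The residual estimate is the
`∀ (a', b')`, Lévy–Prokhorov form ("two-convention endpoint coupling", the `t = 0` twin of
`SAWCircleScreening.EndpointCoupling`, stmt-CriticalPhenomena-5465): the Lévy–Prokhorov distance of
the two curve laws tends to `0`.  This file proves `endpoint coupling → L` (registered signature,
literal), in three soft steps:

* (abstract, namespace `LPMerging`) Lévy–Prokhorov closeness gives bounded-Lipschitz merging,
  quantitatively: `d_LP(μ, ν) < ε ⇒ |∫ g dμ - ∫ g dν| ≤ (L + 2‖g‖) ε` for probability measures and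
  bounded `L`-Lipschitz `g` (`abs_integral_sub_integral_le_of_levyProkhorovEDist_lt`, from Mathlib's
  layer-cake bound `BoundedContinuousFunction.integral_le_of_levyProkhorovEDist_lt` and the Lipschitz
  shift of superlevel sets), hence along a filter (`tendsto_integral_sub_integral`); and a
  probability measure is at Lévy–Prokhorov distance `≥ 1` from `0` (`one_le_levyProkhorovDist_zero`);
* jittered endpoint approximations EXIST for every Dobrushin domain
  (`exists_isEmbEndpointApprox_jittered`: a honeycomb approximation of `B⁻¹E`, which exists by
  `HexEndpointApprox.exists_isEmbEndpointApprox`, is a jittered one of `E` by `embDomainGraph_affine`);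
* the generic SAW law `embLaw` is `0` or a probability measure (`embLaw_zero_or_prob`), and the junk
  value `0` is excluded along the coupling by the distance-`1` remark, so
  `tendsto_integral_sub_integral` and `integral_map` conclude
  (`tendsto_integral_sub_integral_of_tendsto_levyProkhorovDist`, then the registered signature).

All bookkeeping tagged [folklore].
-/

noncomputable section

open MeasureTheory Filter Topology
open scoped NNReal ENNReal
open Literature.Probability.LatticeModels
open Literature.Probability.RandomPlanarGeometry

namespace Summit.CriticalPhenomena.SAWScalingLimit.Cruxes.ModulusUniversality.Birth

/-! ### Lévy–Prokhorov closeness gives bounded-Lipschitz merging (abstract) -/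

namespace LPMerging

open Set

variable {X : Type*} [MeasurableSpace X] [PseudoMetricSpace X] [OpensMeasurableSpace X]

omit [MeasurableSpace X] [OpensMeasurableSpace X] in
/-- Thickening a superlevel set of an `L`-Lipschitz function by `ε` lowers the level by at most
`L ε`. [folklore] -/
theorem thickening_setOf_le_subset {f : X → ℝ} {L : ℝ≥0} (hf : LipschitzWith L f) (ε t : ℝ) :
    Metric.thickening ε {a | t ≤ f a} ⊆ {a | t - L * ε ≤ f a} := by
  intro x hx
  rw [Metric.mem_thickening_iff] at hx
  obtain ⟨y, hy, hxy⟩ := hx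
  have h := hf.dist_le_mul x y
  rw [Real.dist_eq] at h
  have h1 : f y - f x ≤ |f x - f y| := by
    rw [abs_sub_comm]
    exact le_abs_self _
  have h2 : (L : ℝ) * dist x y ≤ L * ε := mul_le_mul_of_nonneg_left hxy.le L.2
  have hy' : t ≤ f y := hy
  show t - L * ε ≤ f x
  linarith

/-- **One-sided Lipschitz–Lévy–Prokhorov bound.** If `d_LP(μ, ν) < ε` then for a nonnegative
bounded `L`-Lipschitz `f`: `∫ f dμ ≤ ∫ f dν + L ε ν(X) + ε ‖f‖` (Mathlib's layer-cake bound
`integral_le_of_levyProkhorovEDist_lt`, the Lipschitz shift of superlevel sets, and the change of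
variables `t ↦ t - Lε` in the layer-cake integral). [folklore] -/
theorem integral_le_integral_add_of_levyProkhorovEDist_lt (μ ν : Measure X) [IsFiniteMeasure μ]
    [IsFiniteMeasure ν] {ε : ℝ} (hε : 0 < ε) (hμν : levyProkhorovEDist μ ν < ENNReal.ofReal ε)
    (f : BoundedContinuousFunction X ℝ) (hf0 : ∀ x, 0 ≤ f x) {L : ℝ≥0}
    (hf : LipschitzWith L f) :
    ∫ x, f x ∂μ ≤ (∫ x, f x ∂ν) + L * ε * ν.real Set.univ + ε * ‖f‖ := by
  set φ : ℝ → ℝ := fun t => ν.real {a | t ≤ f a} with hφ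
  have hφanti : Antitone φ := fun s t hst =>
    measureReal_mono (fun a (ha : t ≤ f a) => hst.trans ha)
  have hφnn : ∀ t, 0 ≤ φ t := fun t => measureReal_nonneg
  have hφle : ∀ t, φ t ≤ ν.real Set.univ := fun t => measureReal_mono (Set.subset_univ _)
  have hf0' : 0 ≤ᵐ[μ] (f : X → ℝ) := Eventually.of_forall hf0
  have hf0'' : 0 ≤ᵐ[ν] (f : X → ℝ) := Eventually.of_forall hf0
  -- Mathlib's layer-cake bound
  have h1 := BoundedContinuousFunction.integral_le_of_levyProkhorovEDist_lt μ ν hε hμν f hf0'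
  -- the thickened superlevel function is antitone as well
  set ψ : ℝ → ℝ := fun t => ν.real (Metric.thickening ε {a | t ≤ f a}) with hψ
  have hψanti : Antitone ψ := fun s t hst =>
    measureReal_mono (Metric.thickening_subset_of_subset ε fun a (ha : t ≤ f a) => hst.trans ha)
  have hM : 0 ≤ ‖f‖ := norm_nonneg _
  have hLε : 0 ≤ (L : ℝ) * ε := by positivity
  -- pointwise comparison and integration over `(0, ‖f‖]`
  have h2 : ∀ t, ψ t ≤ φ (t - L * ε) := fun t =>
    measureReal_mono (thickening_setOf_le_subset hf ε t)
  have hshift : Antitone fun t => φ (t - L * ε) := fun s t hst => hφanti (by linarith)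
  have h3 : ∫ t in Ioc 0 ‖f‖, ψ t ≤ ∫ t in Ioc 0 ‖f‖, φ (t - L * ε) :=
    setIntegral_mono_on (hψanti.intervalIntegrable (a := 0) (b := ‖f‖)).1
      (hshift.intervalIntegrable (a := 0) (b := ‖f‖)).1 measurableSet_Ioc fun t _ => h2 t
  -- change of variables and splitting off `[-Lε, 0]`
  have h4 : ∫ t in Ioc 0 ‖f‖, φ (t - L * ε) ≤ L * ε * ν.real Set.univ + ∫ t in Ioc 0 ‖f‖, φ t := by
    rw [← intervalIntegral.integral_of_le hM, ← intervalIntegral.integral_of_le hM,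
      intervalIntegral.integral_comp_sub_right (fun t => φ t) ((L : ℝ) * ε)]
    have hsplit : ∫ t in (0 - L * ε)..‖f‖, φ t =
        (∫ t in (0 - L * ε)..0, φ t) + ∫ t in (0 : ℝ)..‖f‖, φ t :=
      (intervalIntegral.integral_add_adjacent_intervals hφanti.intervalIntegrable
        hφanti.intervalIntegrable).symm
    have hhead : ∫ t in (0 - L * ε)..0, φ t ≤ L * ε * ν.real Set.univ := by
      have h := intervalIntegral.norm_integral_le_of_norm_le_const (a := 0 - L * ε) (b := 0)
        (C := ν.real Set.univ) (f := φ) fun t _ => by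
          rw [Real.norm_of_nonneg (hφnn t)]
          exact hφle t
      rw [Real.norm_eq_abs] at h
      have h' : |(0 : ℝ) - (0 - L * ε)| = L * ε := by
        rw [sub_sub_cancel, abs_of_nonneg hLε]
      rw [h'] at h
      calc ∫ t in (0 - L * ε)..0, φ t ≤ |∫ t in (0 - L * ε)..0, φ t| := le_abs_self _
        _ ≤ ν.real Set.univ * (L * ε) := h
        _ = L * ε * ν.real Set.univ := by ring
    calc ∫ t in (0 - L * ε)..(‖f‖ - L * ε), φ t
        ≤ ∫ t in (0 - L * ε)..‖f‖, φ t :=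
          intervalIntegral.integral_mono_interval le_rfl (by linarith) (by linarith)
            (Eventually.of_forall fun t => hφnn t) hφanti.intervalIntegrable
      _ = (∫ t in (0 - L * ε)..0, φ t) + ∫ t in (0 : ℝ)..‖f‖, φ t := hsplit
      _ ≤ L * ε * ν.real Set.univ + ∫ t in (0 : ℝ)..‖f‖, φ t := add_le_add hhead le_rfl
  -- layer cake for `ν`
  have h5 : ∫ t in Ioc 0 ‖f‖, φ t = ∫ x, f x ∂ν :=
    (BoundedContinuousFunction.integral_eq_integral_meas_le f ν hf0'').symm
  linarith [h1, h3, h4, h5]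

/-- **Lipschitz–Lévy–Prokhorov bound** for probability measures: if `d_LP(μ, ν) < ε` then for every
bounded `L`-Lipschitz `g`, `|∫ g dμ - ∫ g dν| ≤ (L + 2‖g‖) ε` (apply the one-sided bound to
`g + ‖g‖ ≥ 0` in both directions). [folklore] -/
theorem abs_integral_sub_integral_le_of_levyProkhorovEDist_lt (μ ν : Measure X)
    [IsProbabilityMeasure μ] [IsProbabilityMeasure ν] {ε : ℝ} (hε : 0 < ε)
    (hμν : levyProkhorovEDist μ ν < ENNReal.ofReal ε) (g : BoundedContinuousFunction X ℝ)
    {L : ℝ≥0} (hg : LipschitzWith L g) :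
    |(∫ x, g x ∂μ) - ∫ x, g x ∂ν| ≤ (L + 2 * ‖g‖) * ε := by
  obtain ⟨f, hfx⟩ : ∃ f : BoundedContinuousFunction X ℝ, ∀ x, f x = g x + ‖g‖ :=
    ⟨g + BoundedContinuousFunction.const X ‖g‖, fun x => rfl⟩
  have hf0 : ∀ x, 0 ≤ f x := fun x => by
    rw [hfx]
    have h := (abs_le.1 (g.norm_coe_le_norm x)).1
    linarith
  have hfL : LipschitzWith L f := LipschitzWith.of_dist_le_mul fun x y => by
    rw [hfx, hfx, dist_add_right]
    exact hg.dist_le_mul x y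
  have hfnorm : ‖f‖ ≤ 2 * ‖g‖ := by
    refine (BoundedContinuousFunction.norm_le (by positivity)).2 fun x => ?_
    rw [hfx, Real.norm_eq_abs]
    have h := abs_le.1 (g.norm_coe_le_norm x)
    rw [abs_le]
    constructor <;> linarith [h.1, h.2, norm_nonneg g]
  have hνμ : levyProkhorovEDist ν μ < ENNReal.ofReal ε := by rwa [levyProkhorovEDist_comm]
  have h1 := integral_le_integral_add_of_levyProkhorovEDist_lt μ ν hε hμν f hf0 hfL
  have h2 := integral_le_integral_add_of_levyProkhorovEDist_lt ν μ hε hνμ f hf0 hfL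
  have hintμ : ∫ x, f x ∂μ = (∫ x, g x ∂μ) + ‖g‖ := by
    simp_rw [hfx]
    rw [integral_add (g.integrable μ) (integrable_const _), integral_const, smul_eq_mul,
      probReal_univ, one_mul]
  have hintν : ∫ x, f x ∂ν = (∫ x, g x ∂ν) + ‖g‖ := by
    simp_rw [hfx]
    rw [integral_add (g.integrable ν) (integrable_const _), integral_const, smul_eq_mul,
      probReal_univ, one_mul]
  rw [hintμ, hintν, probReal_univ] at h1
  rw [hintν, hintμ, probReal_univ] at h2
  have hεf : ε * ‖f‖ ≤ ε * (2 * ‖g‖) := mul_le_mul_of_nonneg_left hfnorm hε.le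
  rw [abs_le]
  constructor
  · nlinarith [h2, hεf]
  · nlinarith [h1, hεf]

/-- **Lévy–Prokhorov merging implies bounded-Lipschitz merging.** Two families of (eventually)
probability measures on a pseudo-metric space whose Lévy–Prokhorov distance tends to `0` merge on
every bounded Lipschitz test function. [folklore] -/
theorem tendsto_integral_sub_integral {ι : Type*} {l : Filter ι} {μ ν : ι → Measure X}
    (hμ : ∀ᶠ i in l, IsProbabilityMeasure (μ i)) (hν : ∀ᶠ i in l, IsProbabilityMeasure (ν i))
    (h : Tendsto (fun i => levyProkhorovDist (μ i) (ν i)) l (𝓝 0))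
    (g : BoundedContinuousFunction X ℝ) {L : ℝ≥0} (hg : LipschitzWith L g) :
    Tendsto (fun i => (∫ x, g x ∂(μ i)) - ∫ x, g x ∂(ν i)) l (𝓝 0) := by
  rw [Metric.tendsto_nhds]
  intro ε' hε'
  have hK : 0 < (L : ℝ) + 2 * ‖g‖ + 1 := by positivity
  set ε : ℝ := ε' / ((L : ℝ) + 2 * ‖g‖ + 1) with hεdef
  have hε : 0 < ε := div_pos hε' hK
  have hev : ∀ᶠ i in l, levyProkhorovDist (μ i) (ν i) < ε := by
    have := Metric.tendsto_nhds.1 h ε hε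
    refine this.mono fun i hi => ?_
    rw [Real.dist_eq, sub_zero, abs_of_nonneg] at hi
    · exact hi
    · exact ENNReal.toReal_nonneg
  filter_upwards [hμ, hν, hev] with i hμi hνi hi
  have hE : levyProkhorovEDist (μ i) (ν i) < ENNReal.ofReal ε := by
    have hne : levyProkhorovEDist (μ i) (ν i) ≠ ∞ := levyProkhorovEDist_ne_top _ _
    rw [← ENNReal.ofReal_toReal hne]
    exact (ENNReal.ofReal_lt_ofReal_iff hε).2 hi
  have hb := abs_integral_sub_integral_le_of_levyProkhorovEDist_lt (μ i) (ν i) hε hE g hg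
  rw [Real.dist_eq, sub_zero]
  calc |(∫ x, g x ∂(μ i)) - ∫ x, g x ∂(ν i)| ≤ (L + 2 * ‖g‖) * ε := hb
    _ < ((L : ℝ) + 2 * ‖g‖ + 1) * ε := by
        exact mul_lt_mul_of_pos_right (by linarith) hε
    _ = ε' := by
        rw [hεdef, mul_div_cancel₀ _ hK.ne']

omit [OpensMeasurableSpace X] in
/-- A probability measure is at Lévy–Prokhorov distance `≥ 1` from the zero measure (so
Lévy–Prokhorov merging with probability measures excludes the junk value `0`). [folklore] -/
theorem one_le_levyProkhorovDist_zero (μ : Measure X) [IsProbabilityMeasure μ] :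
    1 ≤ levyProkhorovDist μ 0 := by
  by_contra h
  rw [not_le] at h
  have hne : levyProkhorovEDist μ 0 ≠ ∞ := levyProkhorovEDist_ne_top _ _
  have hE : levyProkhorovEDist μ 0 < 1 := by
    rw [← ENNReal.ofReal_toReal hne, ← ENNReal.ofReal_one]
    exact (ENNReal.ofReal_lt_ofReal_iff one_pos).2 h
  obtain ⟨c, hc, hc1⟩ := exists_between hE
  have key := left_measure_le_of_levyProkhorovEDist_lt hc (MeasurableSet.univ (α := X))
  simp only [measure_univ, Measure.coe_zero, Pi.zero_apply, zero_add] at key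
  exact absurd (key.trans_lt hc1) (lt_irrefl 1)

end LPMerging

/-! ### Jittered endpoint approximations exist; the `embLaw` dichotomy -/

/-- **Jittered endpoint approximations exist for every Dobrushin domain.**  A honeycomb endpoint
approximation of `B⁻¹E = E.map B.symm` (which exists: `HexEndpointApprox.exists_isEmbEndpointApprox`,
"the largest honeycomb component of a Jordan domain is the bulk") IS a jittered-brick-wall endpoint
approximation of `E`: the two `Ω_δ` graphs coincide (`embDomainGraph_affine`) and
`δ B(c) = B(δ c) → B(B⁻¹ pt) = pt`.  In particular the `∃ a' b'` of stub L is never vacuous.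
[folklore] -/
theorem exists_isEmbEndpointApprox_jittered {B : ℂ ≃ₜ ℂ}
    (hB : ∀ z : ℂ, B z = ((2 * z.re : ℝ) : ℂ) + ((2 / Real.sqrt 3 * z.im : ℝ) : ℂ) * Complex.I)
    (E : DobrushinDomain) :
    ∃ a' b' : ℝ → HexVertex,
      SAW.IsEmbEndpointApprox hexGraph (fun v : HexVertex => B (hexCenter v)) E a' b' := by
  have hBsmul : ∀ (r : ℝ) (z : ℂ), B ((r : ℂ) * z) = (r : ℂ) * B z := by
    intro r z
    simp only [hB]
    apply Complex.ext
    · simp only [Complex.add_re, Complex.mul_re, Complex.mul_im, Complex.ofReal_re,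
        Complex.ofReal_im, Complex.I_re, Complex.I_im, Complex.add_im]
      ring
    · simp only [Complex.add_re, Complex.mul_re, Complex.mul_im, Complex.ofReal_re,
        Complex.ofReal_im, Complex.I_re, Complex.I_im, Complex.add_im]
      ring
  have hBline : ∀ (x y : ℂ) (c : ℝ),
      B (AffineMap.lineMap x y c) = AffineMap.lineMap (B x) (B y) c := by
    intro x y c
    rw [AffineMap.lineMap_apply_module', AffineMap.lineMap_apply_module', Complex.real_smul,
      Complex.real_smul]
    simp only [hB]
    apply Complex.ext
    · simp only [Complex.add_re, Complex.add_im, Complex.sub_re, Complex.sub_im, Complex.mul_re,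
        Complex.mul_im, Complex.ofReal_re, Complex.ofReal_im, Complex.I_re, Complex.I_im]
      ring
    · simp only [Complex.add_re, Complex.add_im, Complex.sub_re, Complex.sub_im, Complex.mul_re,
        Complex.mul_im, Complex.ofReal_re, Complex.ofReal_im, Complex.I_re, Complex.I_im]
      ring
  obtain ⟨a', b', h⟩ :=
    Summit.CriticalPhenomena.SAWScalingLimit.Theorems.HexEndpointApprox.exists_isEmbEndpointApprox
      (E.map B.symm)
  refine ⟨a', b', ⟨?_, ?_, ?_⟩⟩
  · refine h.reachable.mono fun δ hδ => ?_
    rw [← embDomainGraph_affine hexGraph hexCenter B hBsmul hBline E.carrier δ,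
      ← MarkedDomain.carrier_map E B.symm]
    exact hδ
  · have h1 := (B.continuous.tendsto _).comp h.tendsto_fst
    rw [MarkedDomain.pt_map, Homeomorph.apply_symm_apply] at h1
    refine h1.congr fun δ => ?_
    rw [Function.comp_apply, hBsmul]
  · have h1 := (B.continuous.tendsto _).comp h.tendsto_snd
    rw [MarkedDomain.pt_map, Homeomorph.apply_symm_apply] at h1
    refine h1.congr fun δ => ?_
    rw [Function.comp_apply, hBsmul]

/-- Junk dichotomy for the generic SAW law: `embLaw` is the zero measure (total weight `0` or `∞`)
or a probability measure (`SAW.isProbabilityMeasure_embLaw`). [folklore] -/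
theorem embLaw_zero_or_prob {V : Type*} (G : SimpleGraph V) (emb : V → ℂ) (Ω : Set ℂ)
    (δ x : ℝ) (a b : V) :
    SAW.embLaw G emb Ω δ x a b = 0 ∨ IsProbabilityMeasure (SAW.embLaw G emb Ω δ x a b) := by
  by_cases h0 : SAW.embWeight G emb Ω δ x a b Set.univ = 0
  · left
    rw [SAW.embLaw, Measure.measure_univ_eq_zero.1 h0, smul_zero]
  by_cases htop : SAW.embWeight G emb Ω δ x a b Set.univ = ∞
  · left
    rw [SAW.embLaw, htop, ENNReal.inv_top, zero_smul]
  · right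
    exact SAW.isProbabilityMeasure_embLaw h0 htop

/-! ### Lévy–Prokhorov merging of the two curve laws gives bounded-Lipschitz merging -/

/-- **Pointwise reduction.** For fixed data `(E; a, b; a', b')`: if the straight brick-wall law is
eventually a probability measure and the Lévy–Prokhorov distance of the two curve laws tends to
`0`, then the two laws merge on every bounded Lipschitz test function of the curve.  The junk
value `0` of the jittered law (`embLaw_zero_or_prob`) is excluded eventually because a probability
measure is at Lévy–Prokhorov distance `≥ 1` from `0` (`LPMerging.one_le_levyProkhorovDist_zero`);
then `LPMerging.tendsto_integral_sub_integral` and `integral_map`. [folklore] -/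
theorem tendsto_integral_sub_integral_of_tendsto_levyProkhorovDist (B : ℂ ≃ₜ ℂ)
    (E : DobrushinDomain) (a b : ℝ → Site 2) (a' b' : ℝ → HexVertex)
    (hprob : ∀ᶠ δ in nhdsWithin 0 (Set.Ioi 0),
      IsProbabilityMeasure (SAW.brickWallLaw E.carrier δ 0 (a δ) (b δ)))
    (hT : Tendsto (fun δ => levyProkhorovDist
        ((SAW.brickWallLaw E.carrier δ 0 (a δ) (b δ)).map (fun γ => γ.curve))
        ((SAW.embLaw hexGraph (fun v : HexVertex => B (hexCenter v)) E.carrier δ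
          SAW.hexCriticalFugacity (a' δ) (b' δ)).map (fun γ => γ.curve)))
      (nhdsWithin 0 (Set.Ioi 0)) (nhds 0))
    (g : BoundedContinuousFunction (CurveClass ℂ) ℝ) {L : ℝ≥0} (hg : LipschitzWith L g) :
    Tendsto (fun δ => (∫ γ, g γ.curve ∂(SAW.brickWallLaw E.carrier δ 0 (a δ) (b δ))) -
        ∫ γ, g γ.curve ∂(SAW.embLaw hexGraph (fun v : HexVertex => B (hexCenter v)) E.carrier δ
          SAW.hexCriticalFugacity (a' δ) (b' δ)))
      (nhdsWithin 0 (Set.Ioi 0)) (nhds 0) := by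
  -- the two curve laws on `CurveClass ℂ`
  set μ : ℝ → Measure (CurveClass ℂ) := fun δ =>
    (SAW.brickWallLaw E.carrier δ 0 (a δ) (b δ)).map (fun γ => γ.curve) with hμ
  set ν : ℝ → Measure (CurveClass ℂ) := fun δ =>
    (SAW.embLaw hexGraph (fun v : HexVertex => B (hexCenter v)) E.carrier δ
      SAW.hexCriticalFugacity (a' δ) (b' δ)).map (fun γ => γ.curve) with hν
  have hμprob : ∀ᶠ δ in nhdsWithin 0 (Set.Ioi 0), IsProbabilityMeasure (μ δ) := by
    filter_upwards [hprob] with δ hδ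
    exact Measure.isProbabilityMeasure_map (SAW.DomainSAW.measurable_of_top _).aemeasurable
  -- the jittered law is eventually a probability measure: `d_LP(prob, 0) ≥ 1`
  have hνprob : ∀ᶠ δ in nhdsWithin 0 (Set.Ioi 0), IsProbabilityMeasure (ν δ) := by
    have hev : ∀ᶠ δ in nhdsWithin 0 (Set.Ioi 0), levyProkhorovDist (μ δ) (ν δ) < 1 := by
      have := Metric.tendsto_nhds.1 hT 1 one_pos
      refine this.mono fun δ hδ => ?_
      rw [Real.dist_eq, sub_zero, abs_of_nonneg] at hδ
      · exact hδ
      · exact ENNReal.toReal_nonneg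
    filter_upwards [hμprob, hev] with δ hμδ hδ
    rcases embLaw_zero_or_prob hexGraph (fun v : HexVertex => B (hexCenter v)) E.carrier δ
      SAW.hexCriticalFugacity (a' δ) (b' δ) with h | h
    · exfalso
      have h0 : ν δ = 0 := by
        simp only [hν, h, Measure.map_zero]
      rw [h0] at hδ
      exact absurd (LPMerging.one_le_levyProkhorovDist_zero (μ δ)) (not_le.2 hδ)
    · exact Measure.isProbabilityMeasure_map (SAW.EmbDomainSAW.measurable_of_top _).aemeasurable
  have key := LPMerging.tendsto_integral_sub_integral hμprob hνprob hT g hg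
  refine key.congr fun δ => ?_
  simp only [hμ, hν]
  rw [integral_map (SAW.DomainSAW.measurable_of_top _).aemeasurable
      g.continuous.aestronglyMeasurable,
    integral_map (SAW.EmbDomainSAW.measurable_of_top _).aemeasurable
      g.continuous.aestronglyMeasurable]

/-! ### The registered helper sub-goal -/

/-- **Two-convention endpoint coupling implies stub L (registered helper sub-goal, literal
signature).**  HYPOTHESIS (the residual lattice estimate, `∀` form, Lévy–Prokhorov): for
`B = diag(2, 2/√3)`, every Dobrushin `E`, every `ℤ²` endpoint approximation `(a, b)` along which
the straight brick-wall law at `t = 0` is eventually a probability measure, and every jittered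
endpoint approximation `(a', b')`, the Lévy–Prokhorov distance between the straight and the
jittered curve laws tends to `0` (the `t = 0`, two-convention twin of
`SAWCircleScreening.EndpointCoupling`, stmt-CriticalPhenomena-5465).  CONCLUSION: the text of stub L
(`stub_jitteredLipMerging`) — some jittered endpoint approximation exists
(`exists_isEmbEndpointApprox_jittered`) and along it the two laws merge on bounded Lipschitz test
functions (`tendsto_integral_sub_integral_of_tendsto_levyProkhorovDist`). [folklore] -/
theorem stub_jitteredLipMerging_of_endpointCoupling : (∀ B : ℂ ≃ₜ ℂ, (∀ z : ℂ, B z = ((2 * z.re : ℝ) : ℂ) + ((2 / Real.sqrt 3 * z.im : ℝ) : ℂ) * Complex.I) → ∀ (E : DobrushinDomain) (a b : ℝ → Site 2) (a' b' : ℝ → HexVertex), SAW.IsEndpointApprox E a b → (∀ᶠ δ in nhdsWithin 0 (Set.Ioi 0), IsProbabilityMeasure (SAW.brickWallLaw E.carrier δ 0 (a δ) (b δ))) → SAW.IsEmbEndpointApprox hexGraph (fun v : HexVertex => B (hexCenter v)) E a' b' → Tendsto (fun δ => levyProkhorovDist ((SAW.brickWallLaw E.carrier δ 0 (a δ) (b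 δ)).map (fun γ => γ.curve)) ((SAW.embLaw hexGraph (fun v : HexVertex => B (hexCenter v)) E.carrier δ SAW.hexCriticalFugacity (a' δ) (b' δ)).map (fun γ => γ.curve))) (nhdsWithin 0 (Set.Ioi 0)) (nhds 0)) → ∀ B : ℂ ≃ₜ ℂ, (∀ z : ℂ, B z = ((2 * z.re : ℝ) : ℂ) + ((2 / Real.sqrt 3 * z.im : ℝ) : ℂ) * Complex.I) → ∀ (E : DobrushinDomain) (a b : ℝ → Site 2), SAW.IsEndpointApprox E a b → (∀ᶠ δ in nhdsWithin 0 (Set.Ioi 0), IsProbabilityMeasure (SAW.brickWallLaw E.carrier δ 0 (a δ) (b δ))) → ∃ a' b' : ℝ → HexVertex, SAW.IsEmbEndpointApprox hexGraph (fun v : HexVertex => B (hexCenter v)) E a' b' ∧ ∀ (g : BoundedContinuousFunction (CurveClass ℂ) ℝ) (L : NNReal), LipschitzWith L g → Tendsto (fun δ => (∫ γ, g γ.curve ∂(SAW.brickWallLaw E.carrier δ 0 (a δ) (b δ))) - ∫ γ, g γ.curve ∂(SAW.embLaw hexGraph (fun v : HexVertex => B (hexCenter v)) E.carrier δ SAW.hexCriticalFugacity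 (a' δ) (b' δ))) (nhdsWithin 0 (Set.Ioi 0)) (nhds 0) := by
  intro h B hB E a b hab hprob
  obtain ⟨a', b', hab'⟩ := exists_isEmbEndpointApprox_jittered hB E
  exact ⟨a', b', hab', fun g L hg =>
    tendsto_integral_sub_integral_of_tendsto_levyProkhorovDist B E a b a' b' hprob
      (h B hB E a b a' b' hab hprob hab') g hg⟩

end Summit.CriticalPhenomena.SAWScalingLimit.Cruxes.ModulusUniversality.Birth

end
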